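import Literature.AlgebraicGeometry.ComplexMultiplication.CMAbelianVarietyHomPrimitiveTypes
import HarnessLib

/-!
# Isomorphic CM pairs have isomorphic weight-one Hodge structures — `V¹_{(K₁,Φ₁)} = ε^* V¹_{(K₀,Φ₀)}` — and, for
# PRIMITIVE types, conversely (Milne CM Prop. 3.13 / GGK §V.B–V.D on `ℚ`-Hodge structures)

Topic `Literature/AlgebraicGeometry/ComplexMultiplication` (family `hodge`, lane `lit-hodgefound`, Layer A3 / A1).
Sequel of `Motives/HodgeStructureOfCMType` (`ofCMType Φ`, `coordSubspace`, `embCoords`),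
`Motives/HodgeStructureOfCMTypeHomSpaces`, `ComplexMultiplication/CMTorusHomSpacesOfTwoTypes`
(`Hom.finrank_eq_of_comp_eq_id`), `CMAbelianVarietyHomRanksOfTwoTypes` / `…SimpleIffEndRank` /
`…HomPrimitiveTypes` (compatible pairs, `Hom ≠ 0 ⟺` isomorphic pairs for primitive types) and
`Motives/GeometricVHSPolarizedTransport` (`HodgeStructure.comapEquiv`).

SOURCES.  M. Green, P. Griffiths, M. Kerr [GreenGriffithsKerr2012] §V.B p. 160 (the Hodge structure `V¹_{(K,Σ)}`
attached to the CM pair `(K, Σ)` — it depends only on the pair), §V.D Prop. V.D.4; P. Deligne [Deligne1982HodgeCycles]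
Example 3.7 («To the pair `(E, Σ)`, there is attached an abelian variety … `H₁(A) ⊗ ℂ ≃ E ⊗_ℚ ℂ ⥲ ℂ^S = ℂ^Σ ⊕ ℂ^{ιΣ}`,
`u ⊗ 1 ↦ (σu)_{σ∈S}`»); J. S. Milne [MilneCM2006] Ch. I §3 Props. 3.12–3.13 (isogeny classes of (simple) CM abelian
varieties ↔ isomorphism classes of (primitive) CM pairs), §5 Prop. 5.2; P. Deligne [DeligneHodgeII1971] 2.1
(transport of Hodge structures).  The statements below are the Hodge-structure form, DERIVED from the cited ones.

WHAT IS PROVED (theorems only; NO definition, NO named fact — D-0026 net debt 0; ANY number fields, unconditional).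
For CM pairs `(K₀; Φ₀)`, `(K₁; Φ₁)` and an isomorphism of pairs `e : K₀ ≃ K₁` (`∀ u, u ∈ Φ₁ ⟺ u ∘ e ∈ Φ₀`, the
hypothesis shape of `SimpleCMAbelianVarietyIsogenyClasses.isIsogenous_iff_exists_ringEquiv`):
* §1 (namespace `Literature.AlgebraicGeometry.Motives.HodgeStructure`) `embCoords_baseChange_of_apply_eq_symm`
  (coordinates transform by `s ↦ s ∘ e⁻¹`) · **`ofCMType_eq_comapEquiv_of_ringEquiv`** (`V¹_{Φ₁} = (e⁻¹)^* V¹_{Φ₀}`: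
  `ofCMType Φ₁ = (ofCMType Φ₀).comapEquiv ε`, `ε = e⁻¹` as a `ℚ`-linear equivalence) ·
  **`exists_hom_ofCMType_comp_eq_id_of_ringEquiv`** (mutually inverse morphisms of Hodge structures
  `V¹_{Φ₁} ⇄ V¹_{Φ₀}` over `e⁻¹`, `e`) · `finrank_hom_ofCMType_eq_of_ringEquiv_left/right` (`Hom` dimensions against
  any third CM Hodge structure agree) · `ncard_setOf_forall_comp_mem_iff_eq_of_ringEquiv_left/right` (the
  compatible-pair counts `#C(Φ₁, Ψ) = #C(Φ₀, Ψ)`, `#C(Ψ, Φ₁) = #C(Ψ, Φ₀)`) · `finrank_end_ofCMType_eq_of_ringEquiv`.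
* §2 **`exists_hom_ofCMType_comp_eq_id_iff_exists_ringEquiv`** — for PRIMITIVE `Φ₀`, `Φ₁`: `V¹_{Φ₁} ≅ V¹_{Φ₀}` as
  `ℚ`-Hodge structures iff the CM pairs are isomorphic (Milne Prop. 3.13 on Hodge structures).
* §3 (namespace `Literature.AlgebraicGeometry.ComplexMultiplication`; realisations `A₀` of `(K₀; Φ₀)`, `A₁` of
  `(K₁; Φ₁)` of ISOMORPHIC pairs) `IsCMTypeRealisation.finrank_hom_eq_finrank_end_of_ringEquiv`
  (`rk_ℤ Hom(A₀, A₁) = rk_ℤ End(A₀)`), `finrank_end_eq_of_ringEquiv` (`rk_ℤ End(A₁) = rk_ℤ End(A₀)`),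
  `dim_eq_of_ringEquiv`, `isSimple_iff_of_ringEquiv` (`A₀` simple ⟺ `A₁` simple) — the numerical shadow of «abelian
  varieties of isomorphic CM types are isogenous» (Shimura §6.1 Cor., the tree's `Shimura1998_Thm2_Cor_holds`).

## Provenance
Lane `lit-hodgefound`, prover seat `lit-hodgefound-p29` (generation 12), self-proposed row g12-#6.

## References
* [GreenGriffithsKerr2012] M. Green, P. Griffiths, M. Kerr, *Mumford–Tate Groups and Domains* (2012) — §V.B p. 160, §V.D
  Prop. V.D.4.
* [Deligne1982HodgeCycles] P. Deligne, *Hodge cycles on abelian varieties*, LNM 900 (1982) — Example 3.7.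
* [DeligneHodgeII1971] P. Deligne, *Théorie de Hodge II* — 2.1.
* [MilneCM2006] J. S. Milne, *Complex Multiplication* (2006) — Ch. I §3 Props. 3.12–3.13, §5 Prop. 5.2.
* [Shimura1998] G. Shimura (1998) — §6.1 Corollary of Theorem 2, §8.2 Prop. 26.
-/

noncomputable section

open scoped TensorProduct
open NumberField CategoryTheory Module

/-! ## §1 Transport of `V¹_{(K,Φ)}` along an isomorphism of CM pairs -/

namespace Literature.AlgebraicGeometry.Motives.HodgeStructure

open RealMult (embCoords embCoords_tmul)

variable {K₀ K₁ K₂ : Type} [Field K₀] [NumberField K₀] [Field K₁] [NumberField K₁] [Field K₂] [NumberField K₂]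
  (Φ₀ : CMType K₀) (Φ₁ : CMType K₁)

/-- The `ℚ`-linear equivalence `e⁻¹ : K₁ ≃ K₀` underlying a field isomorphism of number fields (every ring map is
`ℚ`-linear). [folklore] -/
private theorem exists_linearEquiv_apply_eq_symm (e : K₀ ≃+* K₁) : ∃ ε : K₁ ≃ₗ[ℚ] K₀, ∀ y, ε y = e.symm y :=
  ⟨(AlgEquiv.ofRingEquiv (R := ℚ) (f := e.symm) fun q => by simp).toLinearEquiv, fun _ => rfl⟩

/-- **Coordinates transform by `s ↦ s ∘ e⁻¹`**: for `ε = e⁻¹ : K₁ ≃ K₀` and `x ∈ K₁ ⊗ ℂ`, the `s`-coordinate of `ε_ℂ x`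
(`s : K₀ → ℂ`) is the `(s ∘ e⁻¹)`-coordinate of `x` («`u ⊗ 1 ↦ (σu)_σ`»). [cite: Deligne1982HodgeCycles, Example 3.7]
[cite: GreenGriffithsKerr2012, §V.C] -/
theorem embCoords_baseChange_of_apply_eq_symm (e : K₀ ≃+* K₁) (ε : K₁ →ₗ[ℚ] K₀) (hε : ∀ y, ε y = e.symm y)
    (x : ℂ ⊗[ℚ] K₁) (s : K₀ →+* ℂ) :
    embCoords K₀ (ε.baseChange ℂ x) s = embCoords K₁ x (s.comp e.symm.toRingHom) := by
  induction x using TensorProduct.induction_on with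
  | zero => simp
  | tmul z y =>
      rw [LinearMap.baseChange_tmul, embCoords_tmul, embCoords_tmul, hε]
      rfl
  | add a b ha hb => rw [map_add, map_add, map_add, Pi.add_apply, Pi.add_apply, ha, hb]

/-- **`V¹_{(K₁,Φ₁)} = (e⁻¹)^* V¹_{(K₀,Φ₀)}` for an isomorphism of CM pairs `e : (K₀; Φ₀) ≅ (K₁; Φ₁)`**: there is a
`ℚ`-linear equivalence `ε : K₁ ≃ K₀`, `ε = e⁻¹`, with `ofCMType Φ₁ = (ofCMType Φ₀).comapEquiv ε` — `ε_ℂ` carries the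
line `ℂ_t` to `ℂ_{t ∘ e}`, hence `⊕_{t ∈ Φ₁} ℂ_t` onto `⊕_{s ∈ Φ₀} ℂ_s`. [cite: GreenGriffithsKerr2012, §V.B p. 160]
[cite: Deligne1982HodgeCycles, Example 3.7] [cite: DeligneHodgeII1971, 2.1] -/
theorem ofCMType_eq_comapEquiv_of_ringEquiv (e : K₀ ≃+* K₁)
    (he : ∀ u : K₁ →+* ℂ, u ∈ Φ₁.1 ↔ u.comp e.toRingHom ∈ Φ₀.1) :
    ∃ ε : K₁ ≃ₗ[ℚ] K₀, (∀ x, ε x = e.symm x) ∧ ofCMType Φ₁ = (ofCMType Φ₀).comapEquiv ε := by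
  obtain ⟨ε, hε⟩ := exists_linearEquiv_apply_eq_symm e
  refine ⟨ε, hε, ?_⟩
  have hinj : Function.Injective (ε.toLinearMap.baseChange ℂ) := baseChange_injective_of_equiv ε
  apply HodgeStructure.ext
  funext p
  rw [comapEquiv_F, ofCMType_F, ofCMType_F]
  by_cases hp : p ≤ 0
  · rw [twoStepFiltration_of_le_zero _ hp, twoStepFiltration_of_le_zero _ hp, Submodule.comap_top]
  by_cases hp1 : 1 < p
  · rw [twoStepFiltration_of_lt _ (by omega) hp1, twoStepFiltration_of_lt _ (by omega) hp1, Submodule.comap_bot]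
    exact (LinearMap.ker_eq_bot.2 hinj).symm
  obtain rfl : p = 1 := by omega
  rw [twoStepFiltration_of_pos_of_le _ one_pos le_rfl, twoStepFiltration_of_pos_of_le _ one_pos le_rfl]
  ext x
  simp only [Submodule.mem_comap, mem_coordSubspace_iff]
  constructor
  · -- `x ∈ ⊕_{t ∈ Φ₁} ℂ_t` ⟹ `ε_ℂ x ∈ ⊕_{s ∈ Φ₀} ℂ_s`
    intro h s hs
    rw [embCoords_baseChange_of_apply_eq_symm e _ hε]
    refine h _ fun ht => hs ?_
    rw [he, RingHom.comp_assoc, RingEquiv.symm_toRingHom_comp_toRingHom, RingHom.comp_id] at ht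
    exact ht
  · intro h t ht
    have hs : ¬ t.comp e.toRingHom ∈ Φ₀.1 := fun h' => ht ((he t).2 h')
    have h' := h (t.comp e.toRingHom) hs
    rw [embCoords_baseChange_of_apply_eq_symm e _ hε, RingHom.comp_assoc, RingEquiv.toRingHom_comp_symm_toRingHom,
      RingHom.comp_id] at h'
    exact h'

/-- **Mutually inverse morphisms of Hodge structures `V¹_{(K₁,Φ₁)} ⇄ V¹_{(K₀,Φ₀)}` over `e⁻¹` and `e`** for an
isomorphism of CM pairs. [cite: GreenGriffithsKerr2012, §V.B p. 160] [cite: DeligneHodgeII1971, 2.1] -/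
theorem exists_hom_ofCMType_comp_eq_id_of_ringEquiv (e : K₀ ≃+* K₁)
    (he : ∀ u : K₁ →+* ℂ, u ∈ Φ₁.1 ↔ u.comp e.toRingHom ∈ Φ₀.1) :
    ∃ (f : Hom (ofCMType Φ₁) (ofCMType Φ₀)) (g : Hom (ofCMType Φ₀) (ofCMType Φ₁)),
      g.comp f = Hom.id _ ∧ f.comp g = Hom.id _ ∧ (∀ x, f.toLinearMap x = e.symm x) ∧
        ∀ y, g.toLinearMap y = e y := by
  obtain ⟨ε, hε, hΦ⟩ := ofCMType_eq_comapEquiv_of_ringEquiv Φ₀ Φ₁ e he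
  have hεs : ∀ y, ε.symm y = e y := fun y => by
    apply ε.injective
    rw [LinearEquiv.apply_symm_apply, hε, RingEquiv.symm_apply_apply]
  rw [hΦ]
  exact ⟨⟨ε.toLinearMap, fun p => by
      rintro _ ⟨x, hx, rfl⟩
      exact hx⟩,
    ⟨ε.symm.toLinearMap, fun p => by
      rintro _ ⟨y, hy, rfl⟩
      simp only [comapEquiv_F, Submodule.mem_comap, baseChange_apply_symm_baseChange]
      exact hy⟩,
    Hom.ext (LinearMap.ext fun v => ε.symm_apply_apply v),
    Hom.ext (LinearMap.ext fun w => ε.apply_symm_apply w), hε, hεs⟩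

/-- **`dim Hom_{ℚ-HS}(V¹_Ψ, V¹_{Φ₁}) = dim Hom_{ℚ-HS}(V¹_Ψ, V¹_{Φ₀})`** for isomorphic pairs `(K₀; Φ₀) ≅ (K₁; Φ₁)` and any
third CM Hodge structure `V¹_Ψ`. [cite: MilneCM2006, Ch. I §5 Prop. 5.2] [cite: DeligneHodgeII1971, 2.1] -/
theorem finrank_hom_ofCMType_eq_of_ringEquiv_right (e : K₀ ≃+* K₁)
    (he : ∀ u : K₁ →+* ℂ, u ∈ Φ₁.1 ↔ u.comp e.toRingHom ∈ Φ₀.1) (Ψ : CMType K₂) :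
    finrank ℚ (Hom (ofCMType Ψ) (ofCMType Φ₁)) = finrank ℚ (Hom (ofCMType Ψ) (ofCMType Φ₀)) := by
  obtain ⟨f, g, hgf, hfg, -, -⟩ := exists_hom_ofCMType_comp_eq_id_of_ringEquiv Φ₀ Φ₁ e he
  exact Hom.finrank_eq_of_comp_eq_id g f hfg hgf (Hom.id (ofCMType Ψ)) (Hom.id (ofCMType Ψ))
    (Hom.ext (LinearMap.ext fun _ => rfl)) (Hom.ext (LinearMap.ext fun _ => rfl))

/-- **`dim Hom_{ℚ-HS}(V¹_{Φ₁}, V¹_Ψ) = dim Hom_{ℚ-HS}(V¹_{Φ₀}, V¹_Ψ)`** for isomorphic pairs.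
[cite: MilneCM2006, Ch. I §5 Prop. 5.2] [cite: DeligneHodgeII1971, 2.1] -/
theorem finrank_hom_ofCMType_eq_of_ringEquiv_left (e : K₀ ≃+* K₁)
    (he : ∀ u : K₁ →+* ℂ, u ∈ Φ₁.1 ↔ u.comp e.toRingHom ∈ Φ₀.1) (Ψ : CMType K₂) :
    finrank ℚ (Hom (ofCMType Φ₁) (ofCMType Ψ)) = finrank ℚ (Hom (ofCMType Φ₀) (ofCMType Ψ)) := by
  obtain ⟨f, g, hgf, hfg, -, -⟩ := exists_hom_ofCMType_comp_eq_id_of_ringEquiv Φ₀ Φ₁ e he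
  exact Hom.finrank_eq_of_comp_eq_id (Hom.id (ofCMType Ψ)) (Hom.id (ofCMType Ψ))
    (Hom.ext (LinearMap.ext fun _ => rfl)) (Hom.ext (LinearMap.ext fun _ => rfl)) g f hfg hgf

/-- **`#C(Φ₁, Ψ) = #C(Φ₀, Ψ)`**: the compatible-pair count is an invariant of the isomorphism class of the CM pair
(first variable). [cite: MilneCM2006, Ch. I §5 Prop. 5.2] -/
theorem ncard_setOf_forall_comp_mem_iff_eq_of_ringEquiv_left (e : K₀ ≃+* K₁)
    (he : ∀ u : K₁ →+* ℂ, u ∈ Φ₁.1 ↔ u.comp e.toRingHom ∈ Φ₀.1) (Ψ : CMType K₂) :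
    {q : (K₁ →+* ℂ) × (K₂ →+* ℂ) | ∀ τ : ℂ ≃+* ℂ,
        ((τ : ℂ →+* ℂ).comp q.1 ∈ Φ₁.1 ↔ (τ : ℂ →+* ℂ).comp q.2 ∈ Ψ.1)}.ncard =
      {q : (K₀ →+* ℂ) × (K₂ →+* ℂ) | ∀ τ : ℂ ≃+* ℂ,
        ((τ : ℂ →+* ℂ).comp q.1 ∈ Φ₀.1 ↔ (τ : ℂ →+* ℂ).comp q.2 ∈ Ψ.1)}.ncard := by
  rw [← finrank_hom_ofCMType_eq_ncard, ← finrank_hom_ofCMType_eq_ncard,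
    finrank_hom_ofCMType_eq_of_ringEquiv_right Φ₀ Φ₁ e he Ψ]

/-- **`#C(Ψ, Φ₁) = #C(Ψ, Φ₀)`** (second variable). [cite: MilneCM2006, Ch. I §5 Prop. 5.2] -/
theorem ncard_setOf_forall_comp_mem_iff_eq_of_ringEquiv_right (e : K₀ ≃+* K₁)
    (he : ∀ u : K₁ →+* ℂ, u ∈ Φ₁.1 ↔ u.comp e.toRingHom ∈ Φ₀.1) (Ψ : CMType K₂) :
    {q : (K₂ →+* ℂ) × (K₁ →+* ℂ) | ∀ τ : ℂ ≃+* ℂ,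
        ((τ : ℂ →+* ℂ).comp q.1 ∈ Ψ.1 ↔ (τ : ℂ →+* ℂ).comp q.2 ∈ Φ₁.1)}.ncard =
      {q : (K₂ →+* ℂ) × (K₀ →+* ℂ) | ∀ τ : ℂ ≃+* ℂ,
        ((τ : ℂ →+* ℂ).comp q.1 ∈ Ψ.1 ↔ (τ : ℂ →+* ℂ).comp q.2 ∈ Φ₀.1)}.ncard := by
  rw [← finrank_hom_ofCMType_eq_ncard', ← finrank_hom_ofCMType_eq_ncard',
    finrank_hom_ofCMType_eq_of_ringEquiv_right Φ₀ Φ₁ e he Ψ]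

/-- **`dim End_{ℚ-HS}(V¹_{Φ₁}) = dim End_{ℚ-HS}(V¹_{Φ₀})`** for isomorphic pairs. [cite: MilneCM2006, Ch. I §5 Prop. 5.2] -/
theorem finrank_end_ofCMType_eq_of_ringEquiv (e : K₀ ≃+* K₁)
    (he : ∀ u : K₁ →+* ℂ, u ∈ Φ₁.1 ↔ u.comp e.toRingHom ∈ Φ₀.1) :
    finrank ℚ (Hom (ofCMType Φ₁) (ofCMType Φ₁)) = finrank ℚ (Hom (ofCMType Φ₀) (ofCMType Φ₀)) := by
  rw [finrank_hom_ofCMType_eq_of_ringEquiv_right Φ₀ Φ₁ e he Φ₁, finrank_hom_ofCMType_eq_of_ringEquiv_left Φ₀ Φ₁ e he Φ₀]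

/-! ## §2 Primitive types: `V¹_{Φ₁} ≅ V¹_{Φ₀}` iff the CM pairs are isomorphic -/

/-- **For PRIMITIVE CM types, `V¹_{(K₁,Φ₁)} ≅ V¹_{(K₀,Φ₀)}` as `ℚ`-Hodge structures iff `(K₀; Φ₀) ≅ (K₁; Φ₁)`** (Milne
Prop. 3.13 on Hodge structures: an isomorphism is a non-zero morphism, so the pairs are isomorphic by
`exists_hom_ofCMType_ne_zero_iff_exists_ringEquiv`; conversely §1). [cite: MilneCM2006, Ch. I §3 Prop. 3.13 (p. 30)]
[cite: GreenGriffithsKerr2012, §V.B p. 160 and §V.D Prop. V.D.4] -/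
theorem exists_hom_ofCMType_comp_eq_id_iff_exists_ringEquiv
    (hprim₀ : ∀ s s' : K₀ →+* ℂ,
      (∀ τ : ℂ ≃+* ℂ, (τ : ℂ →+* ℂ).comp s ∈ Φ₀.1 ↔ (τ : ℂ →+* ℂ).comp s' ∈ Φ₀.1) → s = s')
    (hprim₁ : ∀ t t' : K₁ →+* ℂ,
      (∀ τ : ℂ ≃+* ℂ, (τ : ℂ →+* ℂ).comp t ∈ Φ₁.1 ↔ (τ : ℂ →+* ℂ).comp t' ∈ Φ₁.1) → t = t') :
    (∃ (f : Hom (ofCMType Φ₁) (ofCMType Φ₀)) (g : Hom (ofCMType Φ₀) (ofCMType Φ₁)),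
        g.comp f = Hom.id _ ∧ f.comp g = Hom.id _) ↔
      ∃ e : K₀ ≃+* K₁, ∀ u : K₁ →+* ℂ, u ∈ Φ₁.1 ↔ u.comp e.toRingHom ∈ Φ₀.1 := by
  constructor
  · rintro ⟨f, g, hgf, -⟩
    refine (exists_hom_ofCMType_ne_zero_iff_exists_ringEquiv Φ₀ Φ₁ hprim₀ hprim₁).1 ⟨f, fun hf => ?_⟩
    have h1 : (g.comp f).toLinearMap 1 = (1 : K₁) := by rw [hgf]; rfl
    rw [hf] at h1
    exact one_ne_zero (h1.symm.trans (by simp [Hom.comp]))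
  · rintro ⟨e, he⟩
    obtain ⟨f, g, hgf, hfg, -, -⟩ := exists_hom_ofCMType_comp_eq_id_of_ringEquiv Φ₀ Φ₁ e he
    exact ⟨f, g, hgf, hfg⟩

end Literature.AlgebraicGeometry.Motives.HodgeStructure

/-! ## §3 Realisations of isomorphic CM pairs -/

namespace Literature.AlgebraicGeometry.ComplexMultiplication

open Literature.AlgebraicGeometry.Motives (CMType AbelianVariety)
open Literature.AlgebraicGeometry.HodgeTheory (complexBetti)

variable {K₀ K₁ : Type} [Field K₀] [NumberField K₀] [Field K₁] [NumberField K₁] {Φ₀ : CMType K₀} {Φ₁ : CMType K₁}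
  {A₀ A₁ : AbelianVariety ℂ} {ι₀ : 𝓞 K₀ →+* End A₀} {θ₀ : K₀ →+* Module.End ℂ (complexBetti A₀.X 1)}
  {ι₁ : 𝓞 K₁ →+* End A₁} {θ₁ : K₁ →+* Module.End ℂ (complexBetti A₁.X 1)}

/-- **`rk_ℤ Hom(A₀, A₁) = rk_ℤ End(A₀)` for realisations of ISOMORPHIC CM pairs** (`#C(Φ₀, Φ₁) = #C(Φ₀, Φ₀)`) — the
numerical shadow of «abelian varieties of isomorphic CM types are isogenous».
[cite: Shimura1998, §6.1 Corollary of Theorem 2] [cite: MilneCM2006, Ch. I §3 Prop. 3.12 and §5 Prop. 5.2] -/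
theorem IsCMTypeRealisation.finrank_hom_eq_finrank_end_of_ringEquiv (h₀ : IsCMTypeRealisation Φ₀ A₀ ι₀ θ₀)
    (h₁ : IsCMTypeRealisation Φ₁ A₁ ι₁ θ₁) (e : K₀ ≃+* K₁)
    (he : ∀ u : K₁ →+* ℂ, u ∈ Φ₁.1 ↔ u.comp e.toRingHom ∈ Φ₀.1) :
    Module.finrank ℤ (A₀ ⟶ A₁) = Module.finrank ℤ (A₀ ⟶ A₀) := by
  rw [h₀.finrank_hom_eq_ncard h₁, h₀.finrank_end_eq_ncard,
    Motives.HodgeStructure.ncard_setOf_forall_comp_mem_iff_eq_of_ringEquiv_right Φ₀ Φ₁ e he Φ₀]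

/-- **`rk_ℤ End(A₁) = rk_ℤ End(A₀)`** for realisations of isomorphic CM pairs.
[cite: MilneCM2006, Ch. I §5 Prop. 5.2] [cite: Shimura1998, §6.1 Corollary of Theorem 2] -/
theorem IsCMTypeRealisation.finrank_end_eq_of_ringEquiv (h₀ : IsCMTypeRealisation Φ₀ A₀ ι₀ θ₀)
    (h₁ : IsCMTypeRealisation Φ₁ A₁ ι₁ θ₁) (e : K₀ ≃+* K₁)
    (he : ∀ u : K₁ →+* ℂ, u ∈ Φ₁.1 ↔ u.comp e.toRingHom ∈ Φ₀.1) :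
    Module.finrank ℤ (A₁ ⟶ A₁) = Module.finrank ℤ (A₀ ⟶ A₀) := by
  rw [h₁.finrank_end_eq_ncard, h₀.finrank_end_eq_ncard, ← Motives.HodgeStructure.finrank_hom_ofCMType_eq_ncard,
    ← Motives.HodgeStructure.finrank_hom_ofCMType_eq_ncard,
    Motives.HodgeStructure.finrank_end_ofCMType_eq_of_ringEquiv Φ₀ Φ₁ e he]

/-- **`dim A₁ = dim A₀`** for realisations of isomorphic CM pairs (`[K₀:ℚ] = [K₁:ℚ] = 2 dim`).
[cite: Shimura1998, §5.2 («[F : ℚ] = 2n»)] -/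
theorem IsCMTypeRealisation.dim_eq_of_ringEquiv (h₀ : IsCMTypeRealisation Φ₀ A₀ ι₀ θ₀)
    (h₁ : IsCMTypeRealisation Φ₁ A₁ ι₁ θ₁) (e : K₀ ≃+* K₁) : A₁.dim = A₀.dim := by
  have h : finrank ℚ K₁ = finrank ℚ K₀ := by
    rw [← Embeddings.card K₁ ℂ, ← Embeddings.card K₀ ℂ]
    exact Fintype.card_congr
      { toFun := fun t => t.comp e.toRingHom
        invFun := fun s => s.comp e.symm.toRingHom
        left_inv := fun t => by
          change (t.comp e.toRingHom).comp e.symm.toRingHom = t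
          rw [RingHom.comp_assoc, RingEquiv.toRingHom_comp_symm_toRingHom, RingHom.comp_id]
        right_inv := fun s => by
          change (s.comp e.symm.toRingHom).comp e.toRingHom = s
          rw [RingHom.comp_assoc, RingEquiv.symm_toRingHom_comp_toRingHom, RingHom.comp_id] }
  rw [← HodgeTheory.BettiUniverse.finrank_bettiCohomology_one_eq h₀.1 h₀.2.1,
    ← HodgeTheory.BettiUniverse.finrank_bettiCohomology_one_eq h₁.1 h₁.2.1,
    HodgeTheory.finrank_bettiCohomology_one A₀, HodgeTheory.finrank_bettiCohomology_one A₁] at h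
  omega

/-- **`A₀` is simple iff `A₁` is**, for realisations of isomorphic CM pairs (`rk End = 2 dim` on both sides,
`isSimple_iff_finrank_end_eq_two_mul_dim`). [cite: Shimura1998, §8.2 Prop. 26] [cite: MilneCM2006, Ch. I §3 Prop. 3.13] -/
theorem IsCMTypeRealisation.isSimple_iff_of_ringEquiv (h₀ : IsCMTypeRealisation Φ₀ A₀ ι₀ θ₀)
    (h₁ : IsCMTypeRealisation Φ₁ A₁ ι₁ θ₁) (e : K₀ ≃+* K₁)
    (he : ∀ u : K₁ →+* ℂ, u ∈ Φ₁.1 ↔ u.comp e.toRingHom ∈ Φ₀.1) : A₀.IsSimple ↔ A₁.IsSimple := by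
  rw [h₀.isSimple_iff_finrank_end_eq_two_mul_dim, h₁.isSimple_iff_finrank_end_eq_two_mul_dim,
    h₀.finrank_end_eq_of_ringEquiv h₁ e he, h₀.dim_eq_of_ringEquiv h₁ e]

end Literature.AlgebraicGeometry.ComplexMultiplication

end
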